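import Summits.Ventures.PercRepro.Nested
/-!
# PercRepro — C-009 for a cell STATISTIC (typer-2, gen 3)

`conjectures/C-009.md` states the cubic Gladkov inequality for a partition of the cube into cells
`A ⊔ C₁ ⊔ … ⊔ C_r ⊔ B` with every `A ∪ C_i` an up-set (`GladkovSetting`, `C009` in `Nested.lean`,
set indexing `0 = A`, `1 = B`, `i + 2 = C_i`).  p5's three-copy machinery (`LemmaC7/8.lean`) uses
a cell STATISTIC `c : Config E → Fin (r + 2)` with `0 = ⊤ (A)`, `Fin.last (r + 1) = ⊥ (B)` and
`1, …, r` the crossing cells (the convention of `kerC r`).  Here C-009 in that form, equivalently: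

* `e1Of`, `e2Of`, `e3Of` — the elementary symmetric sums of a vector (`e3Vec = e3Of`);
  `e3Of_split`: `e₃(π) = π₀π₁·e₁(mid) + (π₀ + π₁)·e₂(mid) + e₃(mid)`;
* `crossIdx i` — the crossing index `i + 1 ∈ {1, …, r}` of `Fin (r + 2)`; `midStat π` — the
  crossing part of a law in the statistic indexing; `midSet π` — the same in the set indexing;
* `IsGladkovStat c` — every `{c = ⊤} ∪ {c = x_i}` is an up-set; `statLaw p c j = μ(c = j)`;
* **`C009stat`** — C-009 for statistics: `e₃(x) ≤ (T + S)·(T·S − e₂(x))` for the law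
  `T = μ(c = ⊤)`, `S = μ(c = ⊥)`, `x_i = μ(c = x_i)` (the `(T + S)(TS − e₂) ≥ e₃` form of
  C-009.md, i.e. `0 ≤ cubSum (kerC r) (law)` up to the factor `6`);
* `reidx` — the re-indexing `0 ↦ 0`, `1 ↦ last`, `i + 2 ↦ i + 1` from the set to the statistic
  convention; `GladkovSetting.idx`, `GladkovSetting.stat` — the cell index / statistic of a
  Gladkov partition; `IsGladkovStat.cell` — the Gladkov partition of a statistic;
* **`C009_of_C009stat`**, **`C009stat_of_C009`**, **`C009_iff_C009stat`**.

So an abstract Lemma C(r) for statistics gives the row `C009` through `C009_of_C009stat`.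
-/

namespace PercRepro
open Finset
/-! ### Elementary symmetric sums of a vector -/

/-- `e₁` of a vector. -/
def e1Of {n : ℕ} (v : Fin n → ℝ) : ℝ := ∑ i, v i

/-- `e₂` of a vector (sum over `i < j`). -/
def e2Of {n : ℕ} (v : Fin n → ℝ) : ℝ := ∑ i, ∑ j, if i < j then v i * v j else 0

/-- `e₃` of a vector (sum over `i < j < l`). -/
def e3Of {n : ℕ} (v : Fin n → ℝ) : ℝ :=
  ∑ i, ∑ j, ∑ l, if i < j ∧ j < l then v i * v j * v l else 0

/-- `e3Vec` of `Nested.lean` is `e3Of`. -/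
theorem e3Vec_eq_e3Of {n : ℕ} (v : Fin n → ℝ) : e3Vec v = e3Of v := rfl

/-- The middle part of a vector on `Fin (m + 2)` in the SET indexing of `GladkovSetting`
(`0 = A`, `1 = B`, `i + 2 = C_i`). -/
def midSet {m : ℕ} (π : Fin (m + 2) → ℝ) : Fin m → ℝ := fun i => π i.succ.succ

/-- **Splitting `e₃`** along the two distinguished indices `0`, `1`:
`e₃(π) = π₀π₁·e₁(mid) + (π₀ + π₁)·e₂(mid) + e₃(mid)`. -/
theorem e3Of_split {m : ℕ} (π : Fin (m + 2) → ℝ) :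
    e3Of π = π 0 * π 1 * e1Of (midSet π) + (π 0 + π 1) * e2Of (midSet π) + e3Of (midSet π) := by
  have h1 : ∀ x : Fin m, ¬ (x.succ.succ < (1 : Fin (m + 2))) := fun x =>
    not_lt.mpr (Fin.one_lt_succ_succ x).le
  simp only [e3Of, e2Of, e1Of, midSet, Fin.sum_univ_succ, Fin.succ_zero_eq_one, lt_self_iff_false,
    Fin.zero_lt_one, Fin.succ_pos, Fin.succ_lt_succ_iff, Fin.not_lt_zero, h1,
    and_false, true_and, and_true, if_false, if_true, zero_add, add_zero,
    Finset.sum_const_zero]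
  have h2 : ∑ x : Fin m, ∑ x1 : Fin m, (if x < x1 then π 0 * π x.succ.succ * π x1.succ.succ else 0)
      + ∑ x : Fin m, ∑ x1 : Fin m, (if x < x1 then π 1 * π x.succ.succ * π x1.succ.succ else 0)
      = (π 0 + π 1) *
        ∑ x : Fin m, ∑ x1 : Fin m, (if x < x1 then π x.succ.succ * π x1.succ.succ else 0) := by
    rw [Finset.mul_sum, ← Finset.sum_add_distrib]
    refine Finset.sum_congr rfl fun x _ => ?_
    rw [Finset.mul_sum, ← Finset.sum_add_distrib]
    refine Finset.sum_congr rfl fun x1 _ => ?_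
    split_ifs <;> ring
  rw [← h2, Finset.mul_sum]
  ring

/-! ### Symmetrised forms of `e₂`, `e₃` (sums over distinct, unordered indices) -/

/-- Swapping the two variables of a double sum with a symmetric summand. -/
theorem sum_sum_ite_swap {n : ℕ} (v : Fin n → ℝ) (P : Fin n → Fin n → Prop) [DecidableRel P] :
    ∑ i, ∑ j, (if P i j then v i * v j else 0) = ∑ i, ∑ j, (if P j i then v i * v j else 0) := by
  rw [Finset.sum_comm]
  refine Finset.sum_congr rfl fun i _ => Finset.sum_congr rfl fun j _ => ?_
  split_ifs <;> ring

/-- `Σ_{i ≠ j} v_i v_j = 2·e₂(v)`. -/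
theorem sum_ne_eq_two_mul_e2Of {n : ℕ} (v : Fin n → ℝ) :
    ∑ i, ∑ j, (if i ≠ j then v i * v j else 0) = 2 * e2Of v := by
  have h : ∀ i j : Fin n, (if i ≠ j then v i * v j else 0) =
      (if i < j then v i * v j else 0) + (if j < i then v i * v j else 0) := by
    intro i j
    simp only [ne_eq, Fin.lt_def, Fin.ext_iff]
    split_ifs <;> first | (exfalso; omega) | ring1
  simp only [h, Finset.sum_add_distrib]
  rw [sum_sum_ite_swap v (fun i j => j < i)]
  simp only [e2Of]
  ring

/-- Swapping the first two variables of a triple sum with a symmetric summand. -/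
theorem sum3_ite_swap12 {n : ℕ} (v : Fin n → ℝ) (P : Fin n → Fin n → Fin n → Prop)
    [∀ i j l, Decidable (P i j l)] :
    ∑ i, ∑ j, ∑ l, (if P i j l then v i * v j * v l else 0) =
      ∑ i, ∑ j, ∑ l, (if P j i l then v i * v j * v l else 0) := by
  rw [Finset.sum_comm]
  refine Finset.sum_congr rfl fun i _ => Finset.sum_congr rfl fun j _ =>
    Finset.sum_congr rfl fun l _ => ?_
  split_ifs <;> ring

/-- Swapping the last two variables of a triple sum with a symmetric summand. -/
theorem sum3_ite_swap23 {n : ℕ} (v : Fin n → ℝ) (P : Fin n → Fin n → Fin n → Prop)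
    [∀ i j l, Decidable (P i j l)] :
    ∑ i, ∑ j, ∑ l, (if P i j l then v i * v j * v l else 0) =
      ∑ i, ∑ j, ∑ l, (if P i l j then v i * v j * v l else 0) := by
  refine Finset.sum_congr rfl fun i _ => ?_
  rw [Finset.sum_comm]
  refine Finset.sum_congr rfl fun j _ => Finset.sum_congr rfl fun l _ => ?_
  split_ifs <;> ring

/-- `Σ_{i, j, l pairwise distinct} v_i v_j v_l = 6·e₃(v)`. -/
theorem sum_distinct_eq_six_mul_e3Of {n : ℕ} (v : Fin n → ℝ) :
    ∑ i, ∑ j, ∑ l, (if i ≠ j ∧ i ≠ l ∧ j ≠ l then v i * v j * v l else 0) = 6 * e3Of v := by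
  -- the six orderings of a distinct triple
  have h : ∀ i j l : Fin n, (if i ≠ j ∧ i ≠ l ∧ j ≠ l then v i * v j * v l else 0) =
      (if i < j ∧ j < l then v i * v j * v l else 0) +
      (if j < i ∧ i < l then v i * v j * v l else 0) +
      (if i < l ∧ l < j then v i * v j * v l else 0) +
      (if l < i ∧ i < j then v i * v j * v l else 0) +
      (if j < l ∧ l < i then v i * v j * v l else 0) +
      (if l < j ∧ j < i then v i * v j * v l else 0) := by
    intro i j l
    simp only [ne_eq, Fin.lt_def, Fin.ext_iff]
    split_ifs <;> first | (exfalso; omega) | ring1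
  simp only [h, Finset.sum_add_distrib]
  have e1 : ∑ i, ∑ j, ∑ l, (if j < i ∧ i < l then v i * v j * v l else 0) = e3Of v := by
    rw [sum3_ite_swap12 v (fun i j l => j < i ∧ i < l)]; rfl
  have e2 : ∑ i, ∑ j, ∑ l, (if i < l ∧ l < j then v i * v j * v l else 0) = e3Of v := by
    rw [sum3_ite_swap23 v (fun i j l => i < l ∧ l < j)]; rfl
  have e3 : ∑ i, ∑ j, ∑ l, (if l < i ∧ i < j then v i * v j * v l else 0) = e3Of v := by
    rw [sum3_ite_swap23 v (fun i j l => l < i ∧ i < j),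
      sum3_ite_swap12 v (fun i j l => j < i ∧ i < l)]
    rfl
  have e4 : ∑ i, ∑ j, ∑ l, (if j < l ∧ l < i then v i * v j * v l else 0) = e3Of v := by
    rw [sum3_ite_swap12 v (fun i j l => j < l ∧ l < i),
      sum3_ite_swap23 v (fun i j l => i < l ∧ l < j)]
    rfl
  have e5 : ∑ i, ∑ j, ∑ l, (if l < j ∧ j < i then v i * v j * v l else 0) = e3Of v := by
    rw [sum3_ite_swap12 v (fun i j l => l < j ∧ j < i),
      sum3_ite_swap23 v (fun i j l => l < i ∧ i < j),
      sum3_ite_swap12 v (fun i j l => j < i ∧ i < l)]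
    rfl
  rw [e1, e2, e3, e4, e5]
  simp only [e3Of]
  ring

/-! ### The statistic indexing `0 = ⊤`, `Fin.last (r + 1) = ⊥`, `1, …, r` crossing -/

/-- The crossing index `i + 1 ∈ {1, …, r}` of `Fin (r + 2)` (`0 = ⊤`, `Fin.last (r + 1) = ⊥`). -/
def crossIdx {r : ℕ} (i : Fin r) : Fin (r + 2) := i.succ.castSucc

/-- The value of the crossing index is `i + 1`. -/
@[simp] theorem val_crossIdx {r : ℕ} (i : Fin r) : (crossIdx i : ℕ) = i + 1 := rfl

/-- A crossing index is not `⊤ = 0`. -/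
theorem crossIdx_ne_zero {r : ℕ} (i : Fin r) : crossIdx i ≠ 0 := by
  rw [Ne, Fin.ext_iff]; simp

/-- A crossing index is not `⊥ = Fin.last (r + 1)`. -/
theorem crossIdx_ne_last {r : ℕ} (i : Fin r) : crossIdx i ≠ Fin.last (r + 1) := by
  rw [Ne, Fin.ext_iff]; simp; omega

/-- `crossIdx` is injective. -/
theorem crossIdx_injective {r : ℕ} : Function.Injective (crossIdx (r := r)) := by
  intro i j h
  rw [Fin.ext_iff] at h ⊢
  simpa using h

/-- The crossing part of a vector on `Fin (r + 2)` in the STATISTIC indexing. -/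
def midStat {r : ℕ} (π : Fin (r + 2) → ℝ) : Fin r → ℝ := fun i => π (crossIdx i)

/-- **Gladkov's setting for a cell statistic** `c : Config E → Fin (r + 2)`: every
`{c = ⊤} ∪ {c = x_i}` is an up-set (`⊤ = 0`, `x_i = crossIdx i`; `⊥ = Fin.last (r + 1)` is then
the complement of the up-set `⋃ᵢ ({c = ⊤} ∪ {c = x_i})` when `r ≥ 1`). -/
def IsGladkovStat {E : Type*} {r : ℕ} (c : Config E → Fin (r + 2)) : Prop :=
  ∀ i : Fin r, IsUpperSet {ω | c ω = 0 ∨ c ω = crossIdx i}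

section statLaw
variable {E : Type*} [Fintype E] [DecidableEq E]
/-- The law of a statistic: `statLaw p c j = μ(c = j)`. -/
noncomputable def statLaw (p : E → ℝ) {β : Type*} (c : Config E → β) (j : β) : ℝ :=
  prob p (c ⁻¹' {j})

/-- The law of a statistic into a finite type sums to `1`. -/
theorem sum_statLaw (p : E → ℝ) {β : Type*} [Fintype β] [DecidableEq β] (c : Config E → β) :
    ∑ j, statLaw p c j = 1 :=
  sum_prob_fiber p c
end statLaw

/-- **C-009 for a cell statistic** (the index convention of `kerC r`): for every product measure on
a cube and every Gladkov statistic `c : Config E → Fin (r + 2)` with law `T = μ(c = ⊤)`,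
`S = μ(c = ⊥)`, `x_i = μ(c = x_i)`,
`e₃(x) ≤ (T + S)·(T·S − e₂(x))` — the second form of the C-009.md statement, i.e.
`0 ≤ cubSum (kerC r) (law)` up to the factor `6`. -/
def C009stat : Prop :=
  ∀ {E : Type} [Fintype E] [DecidableEq E] (p : E → ℝ), IsProb p →
    ∀ (r : ℕ) (c : Config E → Fin (r + 2)), IsGladkovStat c →
      e3Of (midStat (statLaw p c)) ≤
        (statLaw p c 0 + statLaw p c (Fin.last (r + 1))) *
          (statLaw p c 0 * statLaw p c (Fin.last (r + 1)) - e2Of (midStat (statLaw p c)))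

/-! ### From the set indexing to the statistic indexing -/
/-- The re-indexing from the set convention of `GladkovSetting` (`0 = A`, `1 = B`, `i + 2 = C_i`)
to the statistic convention (`0 = ⊤`, `Fin.last (m + 1) = ⊥`, `i + 1 = x_i`). -/
def reidx {m : ℕ} (j : Fin (m + 2)) : Fin (m + 2) :=
  if j.val = 0 then 0 else if j.val = 1 then Fin.last (m + 1) else ⟨j.val - 1, by omega⟩

/-- `A ↦ ⊤`. -/
theorem reidx_zero {m : ℕ} : reidx (0 : Fin (m + 2)) = 0 := by
  simp [reidx]

/-- `B ↦ ⊥`. -/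
theorem reidx_one {m : ℕ} : reidx (1 : Fin (m + 2)) = Fin.last (m + 1) := by
  simp [reidx]

/-- `C_i ↦ x_i`. -/
theorem reidx_succ_succ {m : ℕ} (i : Fin m) : reidx i.succ.succ = crossIdx i := by
  rw [Fin.ext_iff]; simp [reidx]

/-- `reidx` is injective (hence a permutation of `Fin (m + 2)`). -/
theorem reidx_injective {m : ℕ} : Function.Injective (reidx (m := m)) := by
  intro a b h
  rw [Fin.ext_iff] at h ⊢
  simp only [reidx] at h
  split_ifs at h <;> simp only [Fin.val_zero, Fin.val_last] at h <;> omega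

/-- The algebraic core of the transport: on a probability vector `π` in the set indexing,
`e₃(π) ≤ π₀π₁` is the statistic-form inequality `e₃(mid) ≤ (π₀ + π₁)(π₀π₁ − e₂(mid))`. -/
theorem e3Of_le_iff_of_sum {m : ℕ} (π : Fin (m + 2) → ℝ)
    (hsum : π 0 + π 1 + e1Of (midSet π) = 1) :
    e3Of π ≤ π 0 * π 1 ↔
      e3Of (midSet π) ≤ (π 0 + π 1) * (π 0 * π 1 - e2Of (midSet π)) := by
  rw [e3Of_split π]
  have hs1 : e1Of (midSet π) = 1 - π 0 - π 1 := by linarith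
  rw [hs1]
  constructor <;> intro h <;> nlinarith [h]

namespace GladkovSetting

variable {E : Type*} {m : ℕ} {cell : Fin (m + 2) → Set (Config E)}

/-- Every configuration lies in exactly one cell. -/
theorem existsUnique (hG : GladkovSetting cell) (ω : Config E) : ∃! i, ω ∈ cell i := by
  obtain ⟨i, hi⟩ : ∃ i, ω ∈ cell i := by
    have : ω ∈ ⋃ i, cell i := by rw [hG.cover]; trivial
    exact Set.mem_iUnion.mp this
  refine ⟨i, hi, fun j hj => ?_⟩
  by_contra hne
  exact Set.disjoint_left.mp (hG.disjoint hne) hj hi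

/-- The cell index of a configuration. -/
noncomputable def idx (hG : GladkovSetting cell) (ω : Config E) : Fin (m + 2) :=
  Classical.choose (hG.existsUnique ω).exists

/-- A configuration lies in the cell of its index. -/
theorem mem_idx (hG : GladkovSetting cell) (ω : Config E) : ω ∈ cell (hG.idx ω) :=
  Classical.choose_spec (hG.existsUnique ω).exists

/-- The index of `ω` is `i` iff `ω ∈ cell i`. -/
theorem idx_eq_iff (hG : GladkovSetting cell) (ω : Config E) (i : Fin (m + 2)) :
    hG.idx ω = i ↔ ω ∈ cell i := by
  constructor
  · rintro rfl; exact hG.mem_idx ω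
  · intro hi; exact (hG.existsUnique ω).unique (hG.mem_idx ω) hi

/-- The fibres of the cell index are the cells. -/
theorem preimage_idx (hG : GladkovSetting cell) (i : Fin (m + 2)) : hG.idx ⁻¹' {i} = cell i := by
  ext ω; simp only [Set.mem_preimage, Set.mem_singleton_iff, hG.idx_eq_iff]

/-- The cell statistic of a Gladkov partition, in the statistic indexing. -/
noncomputable def stat (hG : GladkovSetting cell) (ω : Config E) : Fin (m + 2) :=
  reidx (hG.idx ω)

/-- `stat ω = reidx i` iff `ω ∈ cell i`. -/
theorem stat_eq_iff (hG : GladkovSetting cell) (ω : Config E) (i : Fin (m + 2)) :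
    hG.stat ω = reidx i ↔ ω ∈ cell i := by
  rw [stat, reidx_injective.eq_iff, hG.idx_eq_iff]

/-- The fibre of the statistic over `reidx i` is `cell i`. -/
theorem preimage_stat (hG : GladkovSetting cell) (i : Fin (m + 2)) :
    hG.stat ⁻¹' {reidx i} = cell i := by
  ext ω; simp only [Set.mem_preimage, Set.mem_singleton_iff, hG.stat_eq_iff]

/-- The statistic of a Gladkov partition is a Gladkov statistic. -/
theorem isGladkovStat (hG : GladkovSetting cell) : IsGladkovStat hG.stat := by
  intro i
  have h : {ω | hG.stat ω = 0 ∨ hG.stat ω = crossIdx i} = cell 0 ∪ cell i.succ.succ := by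
    ext ω
    simp only [Set.mem_setOf_eq, Set.mem_union]
    have e0 := hG.stat_eq_iff ω 0
    rw [reidx_zero] at e0
    have e1 := hG.stat_eq_iff ω i.succ.succ
    rw [reidx_succ_succ] at e1
    rw [e0, e1]
  rw [h]; exact hG.upper i

variable [Fintype E] [DecidableEq E]

/-- The law of the statistic at `reidx i` is the mass of `cell i`. -/
theorem statLaw_reidx (hG : GladkovSetting cell) (p : E → ℝ) (i : Fin (m + 2)) :
    statLaw p hG.stat (reidx i) = prob p (cell i) := by
  rw [statLaw, hG.preimage_stat]

/-- `μ(stat = ⊤) = μ(A)`. -/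
theorem statLaw_zero (hG : GladkovSetting cell) (p : E → ℝ) :
    statLaw p hG.stat 0 = prob p (cell 0) := by
  have := hG.statLaw_reidx p 0; rwa [reidx_zero] at this

/-- `μ(stat = ⊥) = μ(B)`. -/
theorem statLaw_last (hG : GladkovSetting cell) (p : E → ℝ) :
    statLaw p hG.stat (Fin.last (m + 1)) = prob p (cell 1) := by
  have := hG.statLaw_reidx p 1; rwa [reidx_one] at this

/-- The crossing part of the law of the statistic is the vector of the masses `μ(C_i)`. -/
theorem midStat_statLaw (hG : GladkovSetting cell) (p : E → ℝ) :
    midStat (statLaw p hG.stat) = midSet (fun i => prob p (cell i)) := by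
  funext i
  simp only [midStat, midSet]
  rw [← reidx_succ_succ, hG.statLaw_reidx]

/-- The cell masses of a Gladkov partition sum to `1`. -/
theorem sum_prob_cell (hG : GladkovSetting cell) (p : E → ℝ) :
    prob p (cell 0) + prob p (cell 1) + e1Of (midSet (fun i => prob p (cell i))) = 1 := by
  have h := sum_prob_fiber p hG.idx
  simp only [hG.preimage_idx] at h
  rw [Fin.sum_univ_succ, Fin.sum_univ_succ, Fin.succ_zero_eq_one] at h
  simpa only [e1Of, midSet, add_assoc] using h

end GladkovSetting

/-- **C-009 from its statistic form.** -/
theorem C009_of_C009stat (h : C009stat) : C009 := by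
  intro E _ _ p hp m cell hG
  have key := h p hp m hG.stat hG.isGladkovStat
  rw [hG.statLaw_zero, hG.statLaw_last, hG.midStat_statLaw] at key
  rw [e3Vec_eq_e3Of, e3Of_le_iff_of_sum _ (hG.sum_prob_cell p)]
  exact key

/-! ### From the statistic indexing to the set indexing -/
namespace IsGladkovStat

variable {E : Type*} {r : ℕ} {c : Config E → Fin (r + 2)}

/-- The Gladkov partition of a statistic, in the set indexing: `cell i = {c = reidx i}`. -/
def cell (c : Config E → Fin (r + 2)) (i : Fin (r + 2)) : Set (Config E) := c ⁻¹' {reidx i}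

/-- `reidx` is surjective (a permutation of the finite type `Fin (r + 2)`). -/
theorem reidx_surjective : Function.Surjective (reidx (m := r)) :=
  Finite.injective_iff_surjective.mp reidx_injective

/-- The fibres of a Gladkov statistic form a Gladkov partition. -/
theorem gladkovSetting (hc : IsGladkovStat c) : GladkovSetting (cell c) where
  disjoint := by
    intro i j hij
    rw [Set.disjoint_left]
    intro ω hi hj
    simp only [cell, Set.mem_preimage, Set.mem_singleton_iff] at hi hj
    exact hij (reidx_injective (hi.symm.trans hj))
  cover := by
    ext ω
    simp only [Set.mem_iUnion, cell, Set.mem_preimage, Set.mem_singleton_iff, Set.mem_univ,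
      iff_true]
    obtain ⟨i, hi⟩ := reidx_surjective (c ω)
    exact ⟨i, hi.symm⟩
  upper := by
    intro i
    have h : cell c 0 ∪ cell c i.succ.succ = {ω | c ω = 0 ∨ c ω = crossIdx i} := by
      ext ω
      simp only [cell, Set.mem_union, Set.mem_preimage, Set.mem_singleton_iff, Set.mem_setOf_eq,
        reidx_zero, reidx_succ_succ]
    rw [h]; exact hc i

end IsGladkovStat

/-- **The statistic form of C-009 from the row form.** -/
theorem C009stat_of_C009 (h : C009) : C009stat := by
  intro E _ _ p hp r c hc
  have key := h p hp r (IsGladkovStat.cell c) hc.gladkovSetting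
  have h0 : prob p (IsGladkovStat.cell c 0) = statLaw p c 0 := by
    simp only [IsGladkovStat.cell, statLaw, reidx_zero]
  have h1 : prob p (IsGladkovStat.cell c 1) = statLaw p c (Fin.last (r + 1)) := by
    simp only [IsGladkovStat.cell, statLaw, reidx_one]
  have hmid : midSet (fun i => prob p (IsGladkovStat.cell c i)) = midStat (statLaw p c) := by
    funext i
    simp only [midSet, midStat, IsGladkovStat.cell, statLaw, reidx_succ_succ]
  have hsum := hc.gladkovSetting.sum_prob_cell p
  rw [e3Vec_eq_e3Of, e3Of_le_iff_of_sum _ hsum, h0, h1, hmid] at key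
  exact key

/-- The two forms of C-009 are equivalent. -/
theorem C009_iff_C009stat : C009 ↔ C009stat :=
  ⟨C009stat_of_C009, C009_of_C009stat⟩

end PercRepro
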